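import Literature.NumberTheory.Transcendental.SemialgebraicMapsProofs
import Mathlib.Analysis.Analytic.Constructions
import Mathlib.Analysis.Calculus.FDeriv.Analytic
import Mathlib.Analysis.Calculus.FDeriv.Comp
import Mathlib.MeasureTheory.Function.Jacobian
import Mathlib.Topology.Algebra.Module.Determinant
import HarnessLib

/-!
# Basic calculus of cube charts (refinement of analytic–semialgebraic atlases)

Elementary facts used when an atlas of a bounded set `B ⊆ ℝⁿ` by finitely many charts
`Φᵢ : ℝⁿ → ℝⁿ` — real analytic at every point of a set `K` (the closed unit cube), `ℚ`-semialgebraic,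
injective and with non-vanishing Jacobian determinant on a subset `O ⊆ K` (the open unit cube),
with pairwise disjoint images `Φᵢ(O) ⊆ B` exhausting `B` up to a Lebesgue-null set — is REFINED by a
finite "standard subdivision" `σₘ : ℝⁿ → ℝⁿ` of the cube (same format, `σₘ(K) ⊆ K`, `σₘ(O) ⊆ O`,
disjoint images exhausting `O` up to a null set): the composites `Φᵢ ∘ σₘ` form an atlas of `B` of the
same format (`Literature.NumberTheory.Transcendental.atlas_refine`). Ingredients: the chain rule and
multiplicativity of `det`, composition of semialgebraic maps (Tarski–Seidenberg, from
`SemialgebraicMapsProofs`), and "differentiable images of null sets are null"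
(`MeasureTheory.addHaar_image_eq_zero_of_differentiableOn_of_addHaar_eq_zero`). Also:

* `det_fderiv_ne_zero_of_leftInverse` — a map with a differentiable local left inverse has
  invertible derivative;
* `exists_fin_reindex_atlas` — re-indexing a finite atlas by `Fin N`;
* monomial bookkeeping (`prod_pow_mul_prod_pow`, …) and analyticity of monomials.

These serve the cube–Nash normal form of Kontsevich–Zagier periods (Jung-type induction); nothing here
is specific to it. No definitions are introduced.

## References

* M. Kontsevich, D. Zagier, *Periods* (2001), §1.2 (change of variables between semialgebraic cells).
* E. Bierstone, P. Milman, *Semianalytic and subanalytic sets*, Publ. IHÉS 67 (1988), §4.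
-/

noncomputable section

open Set Filter Topology _root_.MeasureTheory
open Literature.ModelTheory.ExponentialFields (IsSemialgebraic)

namespace Literature.NumberTheory.Transcendental

variable {n : ℕ}

/-! ### Monomials and coordinates -/

/-- `xᵖ · x^q = x^{p+q}`. [folklore] -/
theorem prod_pow_mul_prod_pow (x : Fin n → ℝ) (p q : Fin n → ℕ) :
    (∏ i, x i ^ p i) * (∏ i, x i ^ q i) = ∏ i, x i ^ (p + q) i := by
  rw [← Finset.prod_mul_distrib]
  exact Finset.prod_congr rfl fun i _ => by rw [Pi.add_apply, pow_add]

/-- `(xᵖ)ᵐ = x^{m • p}`. [folklore] -/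
theorem prod_pow_pow (x : Fin n → ℝ) (p : Fin n → ℕ) (m : ℕ) :
    (∏ i, x i ^ p i) ^ m = ∏ i, x i ^ (m • p) i := by
  rw [← Finset.prod_pow]
  exact Finset.prod_congr rfl fun i _ => by rw [Pi.smul_apply, smul_eq_mul, pow_mul']

/-- For `p ≤ q`, `x^q = xᵖ · x^{q-p}`. [folklore] -/
theorem prod_pow_eq_mul_of_le (x : Fin n → ℝ) {p q : Fin n → ℕ} (h : p ≤ q) :
    (∏ i, x i ^ q i) = (∏ i, x i ^ p i) * ∏ i, x i ^ (q i - p i) := by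
  rw [← Finset.prod_mul_distrib]
  exact Finset.prod_congr rfl fun i _ => by rw [← pow_add, Nat.add_sub_cancel' (h i)]

/-- Monomials are non-negative on the closed positive orthant. [folklore] -/
theorem prod_pow_nonneg {x : Fin n → ℝ} (hx : ∀ i, 0 ≤ x i) (p : Fin n → ℕ) :
    0 ≤ ∏ i, x i ^ p i :=
  Finset.prod_nonneg fun i _ => pow_nonneg (hx i) _

/-- Monomials are analytic (coordinates `y ↦ y i` are the analytic maps `ContinuousLinearMap.proj i`).
[folklore] -/
theorem analyticAt_prod_pow (p : Fin n → ℕ) (x : Fin n → ℝ) :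
    AnalyticAt ℝ (fun y : Fin n → ℝ => ∏ i, y i ^ p i) x :=
  Finset.univ.analyticAt_fun_prod fun i _ =>
    ((ContinuousLinearMap.proj (R := ℝ) (φ := fun _ : Fin n => ℝ) i).analyticAt x).pow (p i)

/-! ### Derivatives of maps with a local left inverse -/

/-- If `g ∘ f = id` near `x` with `f` differentiable at `x` and `g` differentiable at `f x`, then
`det Df(x) ≠ 0` (chain rule: `Dg(f x) ∘ Df(x) = id`, and `det` is multiplicative). [folklore] -/
theorem det_fderiv_ne_zero_of_leftInverse {E : Type*} [NormedAddCommGroup E] [NormedSpace ℝ E]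
    {f g : E → E} {x : E} (hf : DifferentiableAt ℝ f x) (hg : DifferentiableAt ℝ g (f x))
    (h : ∀ᶠ y in 𝓝 x, g (f y) = y) : (fderiv ℝ f x).det ≠ 0 := by
  have h1 : fderiv ℝ (g ∘ f) x = (fderiv ℝ g (f x)).comp (fderiv ℝ f x) := fderiv_comp x hg hf
  have h2 : fderiv ℝ (g ∘ f) x = ContinuousLinearMap.id ℝ E := by
    have : (g ∘ f) =ᶠ[𝓝 x] id := h.mono fun y hy => hy
    rw [this.fderiv_eq, fderiv_id]
  have h3 := congrArg ContinuousLinearMap.det (h1.symm.trans h2)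
  simp only [ContinuousLinearMap.det, ContinuousLinearMap.toLinearMap_comp, LinearMap.det_comp,
    ContinuousLinearMap.coe_id, LinearMap.det_id] at h3
  intro h0
  rw [ContinuousLinearMap.det] at h0
  rw [h0, mul_zero] at h3
  exact zero_ne_one h3

/-! ### Refinement of an atlas by a standard subdivision of the cube -/

/-- **Refinement of a chart atlas.** Let `O ⊆ K ⊆ ℝⁿ`. Let `Φᵢ` (`i : ι`, finite) be charts analytic at
`K`, `ℚ`-semialgebraic, injective and with `det DΦᵢ ≠ 0` on `O`, with pairwise disjoint images
`Φᵢ(O) ⊆ B` exhausting `B` up to a null set; let `σₘ` (`m : κ`, finite) be charts of the same format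
with `σₘ(K) ⊆ K`, `σₘ(O) ⊆ O`, pairwise disjoint images `σₘ(O)` exhausting `O` up to a null set. Then
the composites `Φᵢ ∘ σₘ` (`(i, m) : ι × κ`) are charts of the same format with pairwise disjoint images
in `B` exhausting `B` up to a null set (differentiable images of null sets being null).
[folklore] -/
theorem atlas_refine {ι κ : Type*} [Finite ι] {K O B : Set (Fin n → ℝ)} (hOK : O ⊆ K)
    {Φ : ι → (Fin n → ℝ) → (Fin n → ℝ)} {σ : κ → (Fin n → ℝ) → (Fin n → ℝ)}
    (hΦa : ∀ i, AnalyticOnNhd ℝ (Φ i) K) (hΦs : ∀ i, IsSemialgebraicMapOn ℚ O (Φ i))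
    (hΦi : ∀ i, InjOn (Φ i) O) (hΦd : ∀ i, ∀ x ∈ O, (fderiv ℝ (Φ i) x).det ≠ 0)
    (hΦB : ∀ i, Φ i '' O ⊆ B) (hΦdisj : Pairwise fun i i' => Disjoint (Φ i '' O) (Φ i' '' O))
    (hΦnull : volume (B \ ⋃ i, Φ i '' O) = 0)
    (hσa : ∀ m, AnalyticOnNhd ℝ (σ m) K) (hσs : ∀ m, IsSemialgebraicMapOn ℚ O (σ m))
    (hσi : ∀ m, InjOn (σ m) O) (hσd : ∀ m, ∀ x ∈ O, (fderiv ℝ (σ m) x).det ≠ 0)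
    (hσK : ∀ m, MapsTo (σ m) K K) (hσO : ∀ m, MapsTo (σ m) O O)
    (hσdisj : Pairwise fun m m' => Disjoint (σ m '' O) (σ m' '' O))
    (hσnull : volume (O \ ⋃ m, σ m '' O) = 0) :
    (∀ p : ι × κ, AnalyticOnNhd ℝ (Φ p.1 ∘ σ p.2) K ∧ IsSemialgebraicMapOn ℚ O (Φ p.1 ∘ σ p.2) ∧
        InjOn (Φ p.1 ∘ σ p.2) O ∧ ∀ x ∈ O, (fderiv ℝ (Φ p.1 ∘ σ p.2) x).det ≠ 0) ∧
      (∀ p : ι × κ, (Φ p.1 ∘ σ p.2) '' O ⊆ B) ∧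
      Pairwise (fun p p' : ι × κ =>
        Disjoint ((Φ p.1 ∘ σ p.2) '' O) ((Φ p'.1 ∘ σ p'.2) '' O)) ∧
      volume (B \ ⋃ p : ι × κ, (Φ p.1 ∘ σ p.2) '' O) = 0 := by
  have hΦdiff : ∀ i, ∀ x ∈ K, DifferentiableAt ℝ (Φ i) x := fun i x hx =>
    (hΦa i x hx).differentiableAt
  have hσdiff : ∀ m, ∀ x ∈ K, DifferentiableAt ℝ (σ m) x := fun m x hx =>
    (hσa m x hx).differentiableAt
  refine ⟨fun p => ⟨?_, ?_, ?_, ?_⟩, fun p => ?_, ?_, ?_⟩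
  · intro x hx
    exact (hΦa p.1 (σ p.2 x) (hσK p.2 hx)).comp (hσa p.2 x hx)
  · exact IsSemialgebraicMapOn.comp_holds (hΦs p.1) (hσs p.2) (hσO p.2)
  · exact (hΦi p.1).comp (hσi p.2) (hσO p.2)
  · intro x hx
    rw [fderiv_comp x (hΦdiff p.1 _ (hOK (hσO p.2 hx))) (hσdiff p.2 x (hOK hx))]
    intro h0
    simp only [ContinuousLinearMap.det, ContinuousLinearMap.toLinearMap_comp, LinearMap.det_comp,
      mul_eq_zero] at h0
    rcases h0 with h0 | h0
    · exact hΦd p.1 _ (hσO p.2 hx) h0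
    · exact hσd p.2 x hx h0
  · rw [Set.image_comp]
    exact (Set.image_mono (hσO p.2).image_subset).trans (hΦB p.1)
  · intro p p' hne
    simp only [Set.image_comp]
    by_cases h1 : p.1 = p'.1
    · have h2 : p.2 ≠ p'.2 := fun h2 => hne (Prod.ext h1 h2)
      rw [← h1]
      exact (hσdisj h2).image (hΦi p.1) (hσO p.2).image_subset (hσO p'.2).image_subset
    · exact Set.disjoint_of_subset (Set.image_mono (hσO p.2).image_subset)
        (Set.image_mono (hσO p'.2).image_subset) (hΦdisj h1)
  · have hsub : B \ ⋃ p : ι × κ, (Φ p.1 ∘ σ p.2) '' O ⊆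
        (B \ ⋃ i, Φ i '' O) ∪ ⋃ i, Φ i '' (O \ ⋃ m, σ m '' O) := by
      rintro y ⟨hyB, hy⟩
      by_cases h : y ∈ ⋃ i, Φ i '' O
      · right
        obtain ⟨i, hi⟩ := Set.mem_iUnion.1 h
        obtain ⟨x, hx, rfl⟩ := hi
        refine Set.mem_iUnion.2 ⟨i, x, ⟨hx, fun hx' => hy ?_⟩, rfl⟩
        obtain ⟨m, hm⟩ := Set.mem_iUnion.1 hx'
        obtain ⟨v, hv, rfl⟩ := hm
        exact Set.mem_iUnion.2 ⟨(i, m), v, hv, rfl⟩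
      · exact Or.inl ⟨hyB, h⟩
    have : Countable ι := Finite.to_countable
    refine measure_mono_null hsub (measure_union_null hΦnull (measure_iUnion_null fun i => ?_))
    exact addHaar_image_eq_zero_of_differentiableOn_of_addHaar_eq_zero volume
      (fun x hx => (hΦdiff i x (hOK hx.1)).differentiableWithinAt) hσnull

/-! ### Re-indexing a finite atlas by `Fin N` -/

/-- A finite family of charts indexed by a `Fintype` can be re-indexed by `Fin N`, keeping every
per-chart property, pairwise disjointness of the images and the null-remainder condition.
[folklore] -/
theorem exists_fin_reindex_atlas {ι X Y : Type*} [Fintype ι] [MeasurableSpace Y] (μ : Measure Y)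
    (P : X → Prop) (img : X → Set Y) (B : Set Y) (Ψ : ι → X) (hP : ∀ p, P (Ψ p))
    (hdisj : Pairwise fun p p' => Disjoint (img (Ψ p)) (img (Ψ p')))
    (hnull : μ (B \ ⋃ p, img (Ψ p)) = 0) :
    ∃ (N : ℕ) (Φ : Fin N → X), (∀ k, P (Φ k)) ∧
      Pairwise (fun k k' => Disjoint (img (Φ k)) (img (Φ k'))) ∧ μ (B \ ⋃ k, img (Φ k)) = 0 := by
  refine ⟨Fintype.card ι, fun k => Ψ ((Fintype.equivFin ι).symm k), fun k => hP _,
    fun k k' hne => hdisj fun h => hne ((Fintype.equivFin ι).symm.injective h), ?_⟩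
  rw [(Fintype.equivFin ι).symm.surjective.iUnion_comp fun p => img (Ψ p)]
  exact hnull

end Literature.NumberTheory.Transcendental
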